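import Mathlib.Analysis.SpecialFunctions.Pow.Real
import Mathlib.Topology.Algebra.InfiniteSum.Real
import Mathlib.Topology.Algebra.InfiniteSum.Ring
import Mathlib.Tactic.FieldSimp
import Mathlib.Tactic.Positivity
import HarnessLib

/-!
# The ratio lemma for series with non-negative coefficients and a real leading exponent

For a series `g(y) = Σ_{n ≥ 0} a_n y^{Δ+n}` with `a_n ≥ 0` (a conformal block on the diagonal
`z = z̄ = y` for identical external scalars has this form: Hogervorst–Rychkov 2013, §3, with
`a_n = Σ_j A_{n,j} ≥ 0` — `ZSeriesBlockCoefficients.lean`), and `0 < y ≤ y'`: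

  `g(y) ≤ (y/y')^Δ g(y')`                                   (`tsum_rpow_ratio_le`)

termwise, because `a_n y^{Δ+n} = a_n y^Δ y^n ≤ (y/y')^Δ a_n y'^Δ y'^n` (`mul_rpow_add_ratio_le`);
summability at `y` follows from summability at `y'` (`summable_rpow_of_le`); and `g(y') ≥ a_0 y'^Δ`
(`first_term_le_tsum`). Applied with `Δ + N + 1` in place of `Δ` and `a_{n+N+1}` in place of
`a_n` it bounds the TAIL beyond order `N` by `(y/y')^{Δ+N+1}` times the tail at `y'`. This is the
"ratio lemma" that gives the explicit large-`Δ` threshold `Δ_*` — uniform in the spin — for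
diagonal point-evaluation functionals (pub-ising3d REFEREE F25, paper §4): the exchanged-operator
term at the point nearest the origin dominates all others by the factor `(y_i/y_1)^Δ`.
Elementary real analysis; nothing here is specific to conformal blocks. [folklore]
-/

namespace Literature.MathematicalPhysics.QuantumFieldTheory.ConformalBootstrap3D

/-- Termwise ratio bound: for `a ≥ 0`, `0 < y ≤ y'` and any real `Δ`, natural `n`,
`a · y^{Δ+n} ≤ (y/y')^Δ · (a · y'^{Δ+n})`. [folklore] -/
theorem mul_rpow_add_ratio_le {a y y' Δ : ℝ} (ha : 0 ≤ a) (hy : 0 < y) (hyy' : y ≤ y') (n : ℕ) :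
    a * y ^ (Δ + n) ≤ (y / y') ^ Δ * (a * y' ^ (Δ + n)) := by
  have hy' : 0 < y' := lt_of_lt_of_le hy hyy'
  rw [Real.rpow_add hy, Real.rpow_add hy', Real.rpow_natCast, Real.rpow_natCast,
    Real.div_rpow hy.le hy'.le]
  have hΔ' : 0 < y' ^ Δ := Real.rpow_pos_of_pos hy' Δ
  have hΔ : 0 ≤ y ^ Δ := Real.rpow_nonneg hy.le Δ
  have h1 : y ^ n ≤ y' ^ n := pow_le_pow_left₀ hy.le hyy' n
  have heq : y ^ Δ / y' ^ Δ * (a * (y' ^ Δ * y' ^ n)) = a * (y ^ Δ * y' ^ n) := by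
    field_simp
  rw [heq]
  exact mul_le_mul_of_nonneg_left (mul_le_mul_of_nonneg_left h1 hΔ) ha

/-- Each term `a_n y^{Δ+n}` is non-negative for `a_n ≥ 0`, `y ≥ 0`. [folklore] -/
theorem mul_rpow_add_nonneg {a y Δ : ℝ} (ha : 0 ≤ a) (hy : 0 ≤ y) (n : ℕ) :
    0 ≤ a * y ^ (Δ + n) :=
  mul_nonneg ha (Real.rpow_nonneg hy _)

/-- Summability propagates downwards: if `Σ a_n y'^{Δ+n}` converges and `0 < y ≤ y'` then
`Σ a_n y^{Δ+n}` converges (comparison with `(y/y')^Δ` times the series at `y'`). [folklore] -/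
theorem summable_rpow_of_le {a : ℕ → ℝ} {y y' Δ : ℝ} (ha : ∀ n, 0 ≤ a n) (hy : 0 < y)
    (hyy' : y ≤ y') (hs : Summable fun n => a n * y' ^ (Δ + n)) :
    Summable fun n => a n * y ^ (Δ + n) :=
  Summable.of_nonneg_of_le (fun n => mul_rpow_add_nonneg (ha n) hy.le n)
    (fun n => mul_rpow_add_ratio_le (ha n) hy hyy' n) (hs.mul_left _)

/-- **Ratio lemma.** For `a_n ≥ 0`, `0 < y ≤ y'` and `Σ a_n y'^{Δ+n}` convergent,
`Σ_n a_n y^{Δ+n} ≤ (y/y')^Δ · Σ_n a_n y'^{Δ+n}`. (Apply with `Δ ↦ Δ + N + 1`, `a_n ↦ a_{n+N+1}`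
for the tail beyond order `N`.) [folklore] -/
theorem tsum_rpow_ratio_le {a : ℕ → ℝ} {y y' Δ : ℝ} (ha : ∀ n, 0 ≤ a n) (hy : 0 < y)
    (hyy' : y ≤ y') (hs : Summable fun n => a n * y' ^ (Δ + n)) :
    ∑' n, a n * y ^ (Δ + n) ≤ (y / y') ^ Δ * ∑' n, a n * y' ^ (Δ + n) := by
  rw [← tsum_mul_left]
  exact Summable.tsum_le_tsum (fun n => mul_rpow_add_ratio_le (ha n) hy hyy' n)
    (summable_rpow_of_le ha hy hyy' hs) (hs.mul_left _)

/-- The series dominates its first term: `a_0 y^Δ ≤ Σ_n a_n y^{Δ+n}` (all terms non-negative).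
In particular the series is positive when `a_0 > 0`, `y > 0`. [folklore] -/
theorem first_term_le_tsum {a : ℕ → ℝ} {y Δ : ℝ} (ha : ∀ n, 0 ≤ a n) (hy : 0 ≤ y)
    (hs : Summable fun n => a n * y ^ (Δ + n)) :
    a 0 * y ^ Δ ≤ ∑' n, a n * y ^ (Δ + n) := by
  have h := hs.le_tsum 0 (fun j _ => mul_rpow_add_nonneg (ha j) hy j)
  simpa using h

/-- Positivity of the series at `y > 0` when the leading coefficient is positive. [folklore] -/
theorem tsum_rpow_pos {a : ℕ → ℝ} {y Δ : ℝ} (ha : ∀ n, 0 ≤ a n) (ha0 : 0 < a 0) (hy : 0 < y)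
    (hs : Summable fun n => a n * y ^ (Δ + n)) :
    0 < ∑' n, a n * y ^ (Δ + n) :=
  lt_of_lt_of_le (mul_pos ha0 (Real.rpow_pos_of_pos hy Δ)) (first_term_le_tsum ha hy.le hs)

/-- The ratio lemma in "domination" form: for `0 < y ≤ y'`,
`Σ a_n y^{Δ+n} ≤ (y/y')^Δ Σ a_n y'^{Δ+n}` and the right-hand factor `(y/y')^Δ ≤ 1` when
`Δ ≥ 0`; so along the diagonal the block value decreases at least like `(y/y')^Δ`. [folklore] -/
theorem ratio_rpow_le_one {y y' Δ : ℝ} (hy : 0 < y) (hyy' : y ≤ y') (hΔ : 0 ≤ Δ) :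
    (y / y') ^ Δ ≤ 1 := by
  have hy' : 0 < y' := lt_of_lt_of_le hy hyy'
  apply Real.rpow_le_one (div_nonneg hy.le hy'.le) ((div_le_one hy').mpr hyy') hΔ

/-- Monotonicity of the ratio factor in the exponent: for `0 < y ≤ y'` and `Δ ≤ Δ'`,
`(y/y')^{Δ'} ≤ (y/y')^Δ` — larger dimensions are suppressed more; this is what makes the
threshold `Δ_*` of the ratio lemma work for ALL `Δ ≥ Δ_*` at once. [folklore] -/
theorem ratio_rpow_antitone {y y' Δ Δ' : ℝ} (hy : 0 < y) (hyy' : y ≤ y') (hΔ : Δ ≤ Δ') :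
    (y / y') ^ Δ' ≤ (y / y') ^ Δ := by
  have hy' : 0 < y' := lt_of_lt_of_le hy hyy'
  exact Real.rpow_le_rpow_of_exponent_ge (div_pos hy hy') ((div_le_one hy').mpr hyy') hΔ

end Literature.MathematicalPhysics.QuantumFieldTheory.ConformalBootstrap3D
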